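import Summits.Ventures.PercRepro.ProfileThreeFourLine
import Summits.Ventures.PercRepro.C025ProfileHallSimpleReduction

/-!
# PercRepro — THEOREM A IN HALL FORM: THE ROW `q = 3` OF (H⁺) LIFTS OVER A POINT WITHOUT SPLIT SETS, AND THE
REDUCTION OF THE HALL ROW TO THE SIMPLE MATROIDS WITH SHORT LINES (p10, gen 6; `proofs/P10-Q3-NOSPLIT.md` add. 1)

The Hall form of Theorem A: for a non-loop `z` without `z`-split sets at level `u ≥ 4`,
`HallIneq (M ∖ z) 3 u ⟹ HallIneq M 3 u` — for every family `𝒜` of rank-3 sets of `M`, split `𝒜` into the members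
avoiding `z` (`𝒜₀`, a family of `M ∖ z`) and the members through `z` (`𝒜₁`); the members of `𝒜₀` with a positive
loss under the deletion of `z` (`𝒜₀p`) are rank-2 sets of `M ／ z` (no split sets), as are the `B ∖ z`, `B ∈ 𝒜₁`; the
family `𝒜_z := 𝒜₁.image (· ∖ z) ∪ 𝒜₀p` of `M ／ z` carries, at each member `C`, the price of `C ∪ z` and the loss of
`C`, together at most the `(2, u−1)`-price of `C` in `M ／ z` (`price_attached_le`, the price form of
`demand_attached_le`).  The tree's Hall row `q = 2` on `M ／ z` and the Hall hypothesis on `M ∖ z` pay both, and the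
shadows of `𝒜₀` in `M ∖ z` and of `𝒜_z` in `M ／ z` sit inside the shadow of `𝒜` in `M` (the sets avoiding /
containing `z`, p10 g0's `shadowLevel_filter_notMem` / `card_shadowLevel_filter_mem`).  The reduction of the Hall
row to simple matroids with short lines is the Hall twin of `profileIneq_three_of_simple_short_lines` (night-3
g7's `hallIneq_of_delete_isLoop` / `hallIneq_of_delete_parallel_gen`).

* `price_delete_le'`, `price_attached_le`, `price_le_price_contract_erase`, `price_loss_le_price_contract`;
* **`hallIneq_three_of_noSplit`**, **`hallIneq_three_of_four_point_line_simple`**;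
* **`hallIneq_three_of_simple_short_lines`**, **`hallIneq_three_of_simple`**.
-/

open scoped Matroid

namespace PercRepro.Cogirth

open Finset ThmH Skew Shadow Profile

variable {α : Type} [DecidableEq α] {M : Matroid α} [M.Finite]

/-- Deleting `z` does not raise the price of a set `B ∌ z` (price form of `demand_delete_le`). -/
theorem price_delete_le' (q u : ℕ) (hqu : q ≤ u) (B : Finset α) (z : α) :
    price (M ＼ ({z} : Set α)) q u B ≤ price M q u B := by
  have hpos : (0 : ℚ) < u.choose q := by exact_mod_cast Nat.choose_pos hqu
  have h := demand_delete_le (M := M) q u B z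
  have h' : (demand (M ＼ ({z} : Set α)) q u B : ℚ) ≤ demand M q u B := by exact_mod_cast h
  rw [← choose_mul_price_eq_demand q u hqu, ← choose_mul_price_eq_demand q u hqu] at h'
  exact le_of_mul_le_mul_left h' hpos

/-- **The per-set bound in price form**: for a rank-3 set `B' ∋ z` and `C = B' ∖ z`, the price of `B'` in `M` plus
the loss of `C` under the deletion of `z` is at most the `(2, u−1)`-price of `C` in `M ／ z` (`u ≥ 4`). -/
theorem price_attached_le {z : α} (hz : M.Indep {z}) {u : ℕ} (hu : 4 ≤ u) {B' : Finset α} (hzB' : z ∈ B') :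
    price M 3 u B' + (price M 3 u (B'.erase z) - price (M ＼ ({z} : Set α)) 3 u (B'.erase z)) ≤
      price (M ／ ({z} : Set α)) 2 (u - 1) (B'.erase z) := by
  have h := demand_attached_le hz (u := u) (by omega) hzB'
  have hle := demand_delete_le (M := M) 3 u (B'.erase z) z
  have hQ : (3 : ℚ) * ((demand M 3 u B' : ℚ) + ((demand M 3 u (B'.erase z) : ℚ) -
      (demand (M ＼ ({z} : Set α)) 3 u (B'.erase z) : ℚ))) ≤
      (u : ℚ) * (demand (M ／ ({z} : Set α)) 2 (u - 1) (B'.erase z) : ℚ) := by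
    have h' : ((3 * (demand M 3 u B' + (demand M 3 u (B'.erase z) -
        demand (M ＼ ({z} : Set α)) 3 u (B'.erase z))) : ℕ) : ℚ) ≤
        ((u * demand (M ／ ({z} : Set α)) 2 (u - 1) (B'.erase z) : ℕ) : ℚ) := by exact_mod_cast h
    rw [Nat.cast_mul, Nat.cast_add, Nat.cast_sub hle, Nat.cast_mul] at h'
    exact_mod_cast h'
  rw [← choose_mul_price_eq_demand 3 u (by omega), ← choose_mul_price_eq_demand 3 u (by omega),
    ← choose_mul_price_eq_demand 3 u (by omega), ← choose_mul_price_eq_demand 2 (u - 1) (by omega)] at hQ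
  -- `3 · C(u,3) = u · C(u−1,2)`
  have hch : (u : ℚ) * ((u - 1).choose 2 : ℚ) = 3 * (u.choose 3 : ℚ) := by
    have h1 : (u - 1 + 1) * (u - 1).choose 2 = (u - 1 + 1).choose (2 + 1) * (2 + 1) :=
      Nat.add_one_mul_choose_eq (u - 1) 2
    have h2 : u - 1 + 1 = u := by omega
    rw [h2, show (2 : ℕ) + 1 = 3 from rfl] at h1
    exact_mod_cast (by omega : u * (u - 1).choose 2 = 3 * u.choose 3)
  have hpos : (0 : ℚ) < 3 * (u.choose 3 : ℚ) := by
    have : (0 : ℚ) < u.choose 3 := by exact_mod_cast Nat.choose_pos (by omega : 3 ≤ u)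
    linarith
  have hlhs : (3 : ℚ) * ((u.choose 3 : ℚ) * price M 3 u B' + ((u.choose 3 : ℚ) * price M 3 u (B'.erase z) -
      (u.choose 3 : ℚ) * price (M ＼ ({z} : Set α)) 3 u (B'.erase z))) =
      3 * (u.choose 3 : ℚ) * (price M 3 u B' + (price M 3 u (B'.erase z) -
        price (M ＼ ({z} : Set α)) 3 u (B'.erase z))) := by ring
  have hrhs : (u : ℚ) * (((u - 1).choose 2 : ℚ) * price (M ／ ({z} : Set α)) 2 (u - 1) (B'.erase z)) =
      3 * (u.choose 3 : ℚ) * price (M ／ ({z} : Set α)) 2 (u - 1) (B'.erase z) := by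
    rw [← mul_assoc, hch]
  rw [hlhs, hrhs] at hQ
  exact le_of_mul_le_mul_left hQ hpos

/-- The price of a rank-3 set through `z` is at most the `(2, u−1)`-price of `B' ∖ z` in `M ／ z`. -/
theorem price_le_price_contract_erase {z : α} (hz : M.Indep {z}) {u : ℕ} (hu : 4 ≤ u) {B' : Finset α}
    (hzB' : z ∈ B') :
    price M 3 u B' ≤ price (M ／ ({z} : Set α)) 2 (u - 1) (B'.erase z) := by
  have h := price_attached_le hz hu hzB'
  have h2 := price_delete_le' (M := M) 3 u (by omega) (B'.erase z) z
  linarith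

/-- The loss of a rank-3 set `C ∌ z` with `z ∈ cl C` is at most the `(2, u−1)`-price of `C` in `M ／ z`. -/
theorem price_loss_le_price_contract {z : α} (hz : M.Indep {z}) {u : ℕ} (hu : 4 ≤ u) {C : Finset α}
    (hzC : z ∉ C) :
    price M 3 u C - price (M ＼ ({z} : Set α)) 3 u C ≤ price (M ／ ({z} : Set α)) 2 (u - 1) C := by
  have h := price_attached_le hz hu (B' := insert z C) (mem_insert_self z C)
  rw [erase_insert hzC] at h
  have h3 := price_nonneg (M := M) 3 u (insert z C)
  linarith

/-- **THEOREM A, HALL FORM.**  For a non-loop `z` without `z`-split sets at level `u ≥ 4`: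
`HallIneq (M ∖ z) 3 u → HallIneq M 3 u`. -/
theorem hallIneq_three_of_noSplit {z : α} (hz : M.Indep {z}) {u : ℕ} (hu : 4 ≤ u) (hns : NoSplit M z u)
    (hdel : HallIneq (M ＼ ({z} : Set α)) 3 u) : HallIneq M 3 u := by
  intro 𝒜 h𝒜
  have hzE : z ∈ gr M := mem_gr_of_indep hz
  -- the split of the family
  set 𝒜₀ := 𝒜.filter (fun B => z ∉ B) with h𝒜₀
  set 𝒜₁ := 𝒜.filter (fun B => z ∈ B) with h𝒜₁
  set loss : Finset α → ℚ := fun B => price M 3 u B - price (M ＼ ({z} : Set α)) 3 u B with hloss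
  set 𝒜₀p := 𝒜₀.filter (fun B => loss B ≠ 0) with h𝒜₀p
  set 𝒜' := 𝒜₁ ∪ 𝒜₀p with h𝒜'
  have h𝒜'sub : 𝒜' ⊆ 𝒜 := by
    rw [h𝒜']
    apply union_subset (filter_subset _ _)
    exact (filter_subset _ _).trans (filter_subset _ _)
  -- the members of `𝒜₀p` are rank-2 sets of `M ／ z` (no split sets): `z ∈ cl B`
  have hplus : ∀ B ∈ 𝒜₀p, insert z B ∈ Rq M 3 := by
    intro B hB
    rw [h𝒜₀p, mem_filter, h𝒜₀, mem_filter] at hB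
    obtain ⟨⟨hB𝒜, hzB⟩, hl⟩ := hB
    have hBR : B ∈ Rq M 3 := h𝒜 hB𝒜
    have hBg : B ⊆ gr M := (mem_Rq.1 hBR).1
    have hcond : u ≤ rk M (gr M \ B) ∧ rk M ((gr M \ B).erase z) < rk M (gr M \ B) := by
      by_contra hc
      apply hl
      have h0 := loss_eq_zero (M := M) (z := z) (u := u) (B := B) hc
      have hle := demand_delete_le (M := M) 3 u B z
      have hd : demand M 3 u B = demand (M ＼ ({z} : Set α)) 3 u B := by omega
      rw [hloss]
      dsimp only
      have hpos : (0 : ℚ) < u.choose 3 := by exact_mod_cast Nat.choose_pos (by omega : 3 ≤ u)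
      have e1 := choose_mul_price_eq_demand (M := M) 3 u (by omega) B
      have e2 := choose_mul_price_eq_demand (M := M ＼ ({z} : Set α)) 3 u (by omega) B
      have : (u.choose 3 : ℚ) * price M 3 u B = (u.choose 3 : ℚ) * price (M ＼ ({z} : Set α)) 3 u B := by
        rw [e1, e2, hd]
      have := mul_left_cancel₀ hpos.ne' this
      linarith
    have hcl : z ∈ clF M B := hns B hBR hzB hcond.1 hcond.2
    rw [mem_Rq]
    refine ⟨insert_subset hzE hBg, ?_⟩
    have h3 : rk M B = 3 := by unfold rk; rw [(mem_Rq.1 hBR).2, ENat.toNat_coe]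
    rw [← coe_rk, rk_insert_eq hzE hBg, if_pos hcl, h3]
  -- the family in `M ／ z`
  set 𝒜z := 𝒜'.image (fun B => B.erase z) with h𝒜z
  have h𝒜z_sub : 𝒜z ⊆ Rq (M ／ ({z} : Set α)) 2 := by
    intro C hC
    rw [h𝒜z, mem_image] at hC
    obtain ⟨B, hB, rfl⟩ := hC
    rw [h𝒜', mem_union] at hB
    have hBR : B ∈ Rq M 3 := h𝒜 (h𝒜'sub (by rw [h𝒜', mem_union]; exact hB))
    have key : ∀ B' ∈ Rq M 3, z ∈ B' → B'.erase z ∈ Rq (M ／ ({z} : Set α)) 2 := by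
      intro B' hB' hzB'
      rw [mem_Rq] at hB'
      obtain ⟨hBg, hBr⟩ := hB'
      rw [mem_Rq, gr_contract']
      have hC' : B'.erase z ⊆ (gr M).erase z := erase_subset_erase z hBg
      refine ⟨hC', ?_⟩
      have h1 := rk_contract_add_one hz hC'
      rw [insert_erase hzB'] at h1
      have h2 : rk M B' = 3 := by unfold rk; rw [hBr, ENat.toNat_coe]
      rw [← coe_rk]
      have : rk (M ／ ({z} : Set α)) (B'.erase z) = 2 := by omega
      rw [this]
    rcases hB with hB1 | hB0
    · exact key B hBR (mem_filter.1 hB1).2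
    · have hzB : z ∉ B := (mem_filter.1 (mem_filter.1 hB0).1).2
      have := key (insert z B) (hplus B hB0) (mem_insert_self z B)
      rw [erase_insert hzB] at this
      rw [erase_eq_of_notMem hzB]
      exact this
  -- the Hall inequalities of the two minors
  have hH0 := hdel 𝒜₀ (by
    intro B hB
    rw [Rq_delete_eq_filter, mem_filter]
    rw [h𝒜₀, mem_filter] at hB
    exact ⟨h𝒜 hB.1, hB.2⟩)
  have hH1 := hallIneq_two_all_direct (u := u - 1) (by omega) (M ／ ({z} : Set α)) 𝒜z h𝒜z_sub
  -- the demand side: `Σ_𝒜 price = Σ_{𝒜₀} price_{M∖z} + Σ_{𝒜₀} loss + Σ_{𝒜₁} price`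
  have hsplit : ∑ B ∈ 𝒜, price M 3 u B = ∑ B ∈ 𝒜₀, price M 3 u B + ∑ B ∈ 𝒜₁, price M 3 u B := by
    rw [h𝒜₀, h𝒜₁, ← sum_filter_add_sum_filter_not 𝒜 (fun B => z ∉ B)]
    congr 1
    apply sum_congr _ (fun _ _ => rfl)
    ext B; simp only [mem_filter, not_not]
  have hdel_split : ∑ B ∈ 𝒜₀, price M 3 u B =
      ∑ B ∈ 𝒜₀, price (M ＼ ({z} : Set α)) 3 u B + ∑ B ∈ 𝒜₀, loss B := by
    rw [← sum_add_distrib]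
    apply sum_congr rfl
    intro B _
    rw [hloss]; ring
  have hloss_sum : ∑ B ∈ 𝒜₀, loss B = ∑ B ∈ 𝒜₀p, loss B := by
    rw [h𝒜₀p, sum_filter_ne_zero]
  -- the demands through `z` are paid by the `M ／ z`-prices of `𝒜z`
  have h1img : 𝒜₁.image (fun B => B.erase z) ⊆ 𝒜z := by
    rw [h𝒜z, h𝒜']
    exact image_subset_image subset_union_left
  have h0sub : 𝒜₀p ⊆ 𝒜z := by
    intro B hB
    rw [h𝒜z, mem_image]
    refine ⟨B, by rw [h𝒜', mem_union]; exact Or.inr hB, ?_⟩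
    exact erase_eq_of_notMem (mem_filter.1 (mem_filter.1 hB).1).2
  have hsum1 : ∑ B ∈ 𝒜₁, price M 3 u B =
      ∑ C ∈ 𝒜z, if C ∈ 𝒜₁.image (fun B => B.erase z) then price M 3 u (insert z C) else 0 := by
    rw [← sum_filter, filter_mem_eq_inter, inter_eq_right.2 h1img]
    rw [sum_image]
    · apply sum_congr rfl
      intro B hB
      rw [insert_erase (mem_filter.1 hB).2]
    · intro B hB B' hB' heq
      simp only at heq
      rw [← insert_erase (mem_filter.1 (mem_coe.1 hB)).2, ← insert_erase (mem_filter.1 (mem_coe.1 hB')).2, heq]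
  have hsum0 : ∑ B ∈ 𝒜₀p, loss B = ∑ C ∈ 𝒜z, if C ∈ 𝒜₀p then loss C else 0 := by
    rw [← sum_filter, filter_mem_eq_inter, inter_eq_right.2 h0sub]
  have hpay : ∑ B ∈ 𝒜₁, price M 3 u B + ∑ B ∈ 𝒜₀p, loss B ≤
      ∑ C ∈ 𝒜z, price (M ／ ({z} : Set α)) 2 (u - 1) C := by
    rw [hsum1, hsum0, ← sum_add_distrib]
    apply sum_le_sum
    intro C hC
    have hzC : z ∉ C := by
      rw [h𝒜z, mem_image] at hC
      obtain ⟨B, _, rfl⟩ := hC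
      exact notMem_erase z B
    have hA := price_attached_le hz hu (B' := insert z C) (mem_insert_self z C)
    rw [erase_insert hzC] at hA
    have hB := price_le_price_contract_erase hz hu (B' := insert z C) (mem_insert_self z C)
    rw [erase_insert hzC] at hB
    have hL := price_loss_le_price_contract hz hu hzC
    have hP := price_nonneg (M := M ／ ({z} : Set α)) 2 (u - 1) C
    split_ifs with h1 h2 h2
    · rw [hloss]; exact hA
    · rw [add_zero]; exact hB
    · rw [hloss, zero_add]; exact hL
    · rw [add_zero]; exact hP
  -- the shadows: the sets avoiding `z` and the sets containing `z`
  have hsh0 : (shadowLevel (M ＼ ({z} : Set α)) u 𝒜₀).card ≤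
      ((shadowLevel M u 𝒜).filter (fun S => z ∉ S)).card := by
    rw [← shadowLevel_filter_notMem]
    apply card_le_card
    apply filter_subset_filter
    intro S hS
    rw [mem_shadowLevel] at hS ⊢
    obtain ⟨h1, B, hB, hBS⟩ := hS
    exact ⟨h1, B, (filter_subset _ _) hB, hBS⟩
  have hsh1 : (shadowLevel (M ／ ({z} : Set α)) (u - 1) 𝒜z).card ≤
      ((shadowLevel M u 𝒜).filter (fun S => z ∈ S)).card := by
    rw [h𝒜z, ← card_shadowLevel_filter_mem hz (by omega : 1 ≤ u)]
    apply card_le_card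
    apply filter_subset_filter
    intro S hS
    rw [mem_shadowLevel] at hS ⊢
    obtain ⟨h1, B, hB, hBS⟩ := hS
    exact ⟨h1, B, h𝒜'sub hB, hBS⟩
  have hcard : ((shadowLevel M u 𝒜).filter (fun S => z ∉ S)).card +
      ((shadowLevel M u 𝒜).filter (fun S => z ∈ S)).card = (shadowLevel M u 𝒜).card := by
    rw [add_comm]
    exact card_filter_add_card_filter_not (s := shadowLevel M u 𝒜) (fun S => z ∈ S)
  -- assemble
  rw [hsplit, hdel_split, hloss_sum]
  have hH0' : ∑ B ∈ 𝒜₀, price (M ＼ ({z} : Set α)) 3 u B ≤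
      (((shadowLevel M u 𝒜).filter (fun S => z ∉ S)).card : ℚ) :=
    hH0.trans (by exact_mod_cast hsh0)
  have hH1' : ∑ C ∈ 𝒜z, price (M ／ ({z} : Set α)) 2 (u - 1) C ≤
      (((shadowLevel M u 𝒜).filter (fun S => z ∈ S)).card : ℚ) :=
    hH1.trans (by exact_mod_cast hsh1)
  have hcardQ : (((shadowLevel M u 𝒜).filter (fun S => z ∉ S)).card : ℚ) +
      (((shadowLevel M u 𝒜).filter (fun S => z ∈ S)).card : ℚ) = ((shadowLevel M u 𝒜).card : ℚ) := by
    exact_mod_cast hcard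
  linarith

/-- **THE HALL ROW `q = 3` LIFTS OVER A POINT OF A `≥ 4`-POINT LINE OF A SIMPLE MATROID**: for simple `M`, a rank-2
set `L ∋ z` with `≥ 4` points and `u ≥ 4`, `HallIneq (M ∖ z) 3 u → HallIneq M 3 u`. -/
theorem hallIneq_three_of_four_point_line_simple (hs : Simple' M) {z : α} (hz : z ∈ gr M) {L : Finset α}
    (hL : L ⊆ gr M) (hzL : z ∈ L) (hrL : rk M L = 2) (hcard : 4 ≤ L.card) {u : ℕ} (hu : 4 ≤ u)
    (hdel : HallIneq (M ＼ ({z} : Set α)) 3 u) : HallIneq M 3 u := by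
  have hzi : M.Indep ({z} : Set α) := by
    have := hs {z} (singleton_subset_iff.2 hz) (by simp)
    simpa using this
  exact hallIneq_three_of_noSplit hzi hu
    (noSplit_of_four_point_line hz hL hzL hrL hcard
      (fun x hx y hy hxy => rk_pair_of_simple' hs (hL hx) (hL hy) hxy) u) hdel


/-- **THE REDUCTION OF THE HALL ROW `q = 3` TO SIMPLE MATROIDS WITH SHORT LINES** (`u ≥ 4`). -/
theorem hallIneq_three_of_simple_short_lines {u : ℕ} (hu : 4 ≤ u)
    (hS : ∀ (N : Matroid α) [N.Finite], Simple' N → (∀ L ⊆ gr N, rk N L = 2 → L.card ≤ 3) →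
      HallIneq N 3 u)
    (M : Matroid α) [M.Finite] : HallIneq M 3 u := by
  suffices h : ∀ n : ℕ, ∀ (N : Matroid α) [N.Finite], (gr N).card = n → HallIneq N 3 u from h _ M rfl
  intro n
  induction n using Nat.strong_induction_on with
  | _ n ih =>
  intro N _ hN
  by_cases hloop : ∃ ℓ, N.IsLoop ℓ
  · obtain ⟨ℓ, hℓ⟩ := hloop
    have hℓE : ℓ ∈ gr N := by rw [← Finset.mem_coe, coe_gr]; exact hℓ.mem_ground
    apply hallIneq_of_delete_isLoop hℓ
    apply ih ((gr N).erase ℓ).card _ (N ＼ ({ℓ} : Set α)) (by rw [gr_delete_singleton''])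
    rw [← hN]; exact Finset.card_erase_lt_of_mem hℓE
  · have hl : ∀ x ∈ N.E, N.IsNonloop x := fun x hx => N.isNonloop_of_not_isLoop hx (fun h => hloop ⟨x, h⟩)
    by_cases hpar : ∃ e f, f ∈ N.E ∧ f ≠ e ∧ e ∈ N.closure {f}
    · obtain ⟨e, f, hfE, hfe, hef⟩ := hpar
      have heE : e ∈ gr N := by rw [← Finset.mem_coe, coe_gr]; exact N.closure_subset_ground _ hef
      have hlt : ((gr N).erase e).card < n := by rw [← hN]; exact Finset.card_erase_lt_of_mem heE
      have hu' : u = (u - 1) + 1 := by omega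
      rw [hu']
      apply hallIneq_of_delete_parallel_gen hl hfE hfe hef (by omega)
      · rw [← hu']
        exact ih _ hlt (N ＼ ({e} : Set α)) (by rw [gr_delete_singleton''])
      · exact hallIneq_two_all_direct (by omega) (N ／ ({e} : Set α))
    · have hs : Simple' N := simple'_of_no_loop_no_parallel hl
        (fun e f hfE hfe hef => hpar ⟨e, f, hfE, hfe, hef⟩)
      by_cases hline : ∃ L ⊆ gr N, rk N L = 2 ∧ 4 ≤ L.card
      · obtain ⟨L, hL, hrL, hcard⟩ := hline
        have hne : L.Nonempty := Finset.card_pos.1 (by omega)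
        obtain ⟨z, hzL⟩ := hne
        have hzE : z ∈ gr N := hL hzL
        have hlt : ((gr N).erase z).card < n := by rw [← hN]; exact Finset.card_erase_lt_of_mem hzE
        apply hallIneq_three_of_four_point_line_simple hs hzE hL hzL hrL hcard hu
        exact ih _ hlt (N ＼ ({z} : Set α)) (by rw [gr_delete_singleton''])
      · exact hS N hs (fun L hL hrL => by
          by_contra h
          exact hline ⟨L, hL, hrL, by omega⟩)

/-- **THE HALL ROW `q = 3` ON EVERY FINITE MATROID FROM THE HALL ROW ON SIMPLE MATROIDS** (`u ≥ 4`). -/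
theorem hallIneq_three_of_simple {u : ℕ} (hu : 4 ≤ u)
    (hS : ∀ (N : Matroid α) [N.Finite], Simple' N → HallIneq N 3 u) (M : Matroid α) [M.Finite] :
    HallIneq M 3 u :=
  hallIneq_three_of_simple_short_lines hu (fun N _ hs _ => hS N hs) M


end PercRepro.Cogirth
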